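import Summits.BirchSwinnertonDyer.Rank1Residual.X5.TwoAdicTargetsMultKatoRat
import Literature.NumberTheory.EllipticCurves.Zhai2021.TwoAdicLowerBoundTwists
import HarnessLib

/-!
# Route ByReductionTypeAtTwo, crux `MultUpperHalfAtTwo` (stmt-BirchSwinnertonDyer-19922) — the layer-3
# CHILD statements as CLOSED `Prop` leaves in a standalone Theorems module (importable by the route file;
# no Theses file imported)

Why this file exists (seat bsd-2adic-mult-2, 2026-08-26; the pattern of `ByReductionTypeAtTwoOrdHalvesDefs.lean`):
the two landed reductions of the crux `MultUpperHalfAtTwo` —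
`Theorems.multUpperHalfAtTwo_of_integralKatoAtOptimal` (p420150: crux ⟸ five PRINT facts + Greenberg–Stevens
at a split `2` + Kato's divisibility IN `Λ` at the `X₀(N)`-optimal curve of each class) and
`Theorems.multUpperHalfAtTwo_of_optimalMuZero_of_offRoad` (p418902: crux ⟸ PRINT + Kato `⊗ℚ` + GS + the
residual «optimal curves whose cyclotomic `μ` is not known to vanish») — carry their open inputs as long
binders. For a `route edit --split` of item 19922 the planner needs each open input as ONE closed constant
that (i) a route file can import (this module imports no Theses file) and (ii) the dependency scanner sees
AS the crux (`@[conjecture]`, nothing asserted). Each constant below is the corresponding binder VERBATIM;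
`Iff.rfl` lemmas record that nothing was changed. The glue terms are one application of the landed
theorems (their binder types unfold to these constants by `rfl`).

HONEST FRAMING (cell `bsd-2adic`): typed targets only; nothing asserted, nothing booked; BSD is not proved
by any of this. PARTITION: X5@2 mult (K4ᵐ, B1·O1; 1 976 classes) × p = 2 — types-the-object-of; closes none.
-/

set_option autoImplicit false
set_option linter.dupNamespace false

noncomputable section

open scoped Classical MatrixGroups ModularForm

open CongruenceSubgroup WeierstrassCurve Literature.NumberTheory.EllipticCurves
  Literature.NumberTheory.EllipticCurves.ModularForms
  Literature.NumberTheory.EllipticCurves.Greenberg1999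
  Literature.NumberTheory.EllipticCurves.Rank1Residual
  Literature.NumberTheory.EllipticCurves.Rank1Residual.Typed
  Summit.BirchSwinnertonDyer.Rank1Residual.X5

namespace Summit.BirchSwinnertonDyer.BirchSwinnertonDyer.Theorems.MultUpperHalvesAtTwo

/-- [crux, MEMO] **Greenberg–Stevens at a SPLIT multiplicative `2`, for every curve** — the binder `hGS` of
both landed reductions: for every globally minimal elliptic `W/ℚ` with split multiplicative reduction at `2`,
`greenberg_stevens (W := W) (p := 2)` (`[T¹]L · log₂ γ = 𝓛₂(E) · [0]⁺_f` for every newform, every split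
`2`-adic `L`-function and every Tate datum). Printed for `p ≥ 5` (Greenberg–Stevens 1993) and odd `p`
(Kobayashi 2006 Cor. 4.2); at `p = 2` the cell's memo HOME mult/PROOF-GS2.md (referee RC-4 PASS), NOT in print.
Nothing asserted. [cite: Kobayashi2006DocMath, Cor. 4.2 (p. 575; shape, odd p)]
[cite: GreenbergStevens1993, Thm. (p ≥ 5; shape)] -/
@[conjecture] def GreenbergStevensAtSplitTwo : Prop :=
  ∀ (W : WeierstrassCurve ℚ) [W.IsElliptic] [W.IsGloballyMinimal],
    W.HasSplitMultiplicativeReductionAtPrime 2 → greenberg_stevens (W := W) (p := 2)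

/-- [crux, MEMO] **Kato `⊗ℚ` at a multiplicative `2`, for every non-CM curve** — the binder `hKato` of
p409679 / p418902: `O1.KatoMultiplicativeDivisibilityRat W 2` for every globally minimal non-CM `W`
multiplicative at `2` (the cell's memo HOME mult/PROOF-MULT.md, referee RC-2 PASS; Kato 2004 Thm. 17.4 /
17.13 read `⊗ℚ` at `p = 2 ∣ N`; in print only for odd `p` under extra hypotheses). Nothing asserted.
[cite: Kato2004Asterisque, Thm. 17.4 (1)(2) (p. 273) and 17.13 (pp. 279–280) (shape)]
[cite: Kobayashi2006DocMath, Thm. 4.1 (shape, odd p)] -/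
@[conjecture] def KatoRatAtMultTwo : Prop :=
  ∀ (W : WeierstrassCurve ℚ) [W.IsElliptic] [W.IsGloballyMinimal],
    ¬ W.HasCM → Mult W 2 → O1.KatoMultiplicativeDivisibilityRat W 2

/-- [crux] **Kato's divisibility IN `Λ`, Néron-normalised, at the `X₀(N)`-optimal curve of each class** — the
binder `hKint` of `Theorems.multUpperHalfAtTwo_of_integralKatoAtOptimal` (p420150) VERBATIM: for every globally
minimal non-CM `W₀` of analytic rank `0`, multiplicative at `2`, carrying a lattice-optimal parametrisation
datum at level `N_{W₀}` (`Zhai2021.IsOptimalDatum`: `W₀` is the strong Weil curve), every cyclotomic datum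
`(κ, γ)`, the newform `f`, every period ratio `ϖ` (`ϖ · Ω_{W₀} = Ω⁺_f`; a `2`-adic unit here by Česnavičius
2018) and every dual datum `D` of `Sel_{2^∞}(E₀/ℚ_∞)`: `X` is torsion and `ϖ · L ∈ ι(char_Λ X)` (non-split),
`ϖ · L ∈ ι(T · char_Λ X)` (split; trivial zero charged to the local condition). This is Kato 2004 Thm. 17.4
(3) / 17.13 at the prime `p = 2 ∣ N` the printed theorem excludes, restricted to optimal curves; believed
(Kato half of the `2`-adic main conjecture), NOT in print; on the classes with `μ(X(E₀/ℚ_∞)) = 0` it follows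
from `KatoRatAtMultTwo` (`Theorems.integralKato_of_katoRat_of_mu_eq_zero_of_period`). Nothing asserted.
[cite: Kato2004Asterisque, Thm. 17.4 (3) (p. 273; p ≠ 2 in print) and 17.13 (shape)] -/
@[conjecture] def IntegralKatoAtOptimalMultTwo : Prop :=
  ∀ (W₀ : WeierstrassCurve ℚ) [W₀.IsElliptic] [W₀.IsGloballyMinimal]
    [NeZero (W₀.conductorNorm ℤ)], ¬ W₀.HasCM → W₀.analyticRank = 0 → Mult W₀ 2 →
    ∀ D₀ : ModularParametrizationData W₀ (W₀.conductorNorm ℤ), Zhai2021.IsOptimalDatum W₀ D₀ →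
    ∀ (κ : ZpExtension ℚ 2) (γ : Field.absoluteGaloisGroup ℚ), κ.IsCyclotomic → κ.IsTopGenerator γ →
    IsCyclotomicVariable 2 γ →
    ∀ (f : CuspForm (Gamma0 (W₀.conductorNorm ℤ)) 2), IsNewformOf W₀ f →
    ∀ ϖ : ℚ, (ϖ : ℝ) * W₀.realPeriodRat = plusPeriod f → ∀ D : W₀.SelmerDualData κ γ,
      D.IsTorsion ∧
      (¬ W₀.HasSplitMultiplicativeReductionAtPrime 2 →
        ∀ L : PowerSeries ℚ_[2], IsMultPAdicLFunctionOf f 2 (-1) L →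
          ∃ g ∈ D.charIdeal, iwasawaToPowerSeries 2 g = PowerSeries.C (ϖ : ℚ_[2]) * L) ∧
      (W₀.HasSplitMultiplicativeReductionAtPrime 2 →
        ∀ L : PowerSeries ℚ_[2], IsSplitMultPAdicLFunctionOf f 2 L →
          ∃ g ∈ D.charIdeal,
            iwasawaToPowerSeries 2 (PowerSeries.X * g) = PowerSeries.C (ϖ : ℚ_[2]) * L)

/-- [crux, RESIDUAL] **The upper half OFF the «μ = 0 at the optimal curve» road** — the binder `hoff` of
`Theorems.multUpperHalfAtTwo_of_optimalMuZero_of_offRoad` (p418902) VERBATIM: `MissingUpperBoundAt W₀ 2` for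
every `X₀(N)`-optimal globally minimal non-CM `W₀` of analytic rank `0` multiplicative at `2` (lattice-optimal
datum at level `N_{W₀}`) whose cyclotomic `μ`-invariant is NOT known to vanish (no `μ = 0` for all cyclotomic
dual data, no Prop-5.14 datum). Expected to be exactly the classes with `μ(E₀) ≥ 1`, where the `μ`-part of
Kato's divisibility at `2` is needed (not in print). Nothing asserted.
[cite: GreenbergLNM1716, Prop. 5.13, Prop. 5.14 and §4 pp. 112–113 (shape)] [cite: Miller2011LMS, Def. 1.1] -/
@[conjecture] def UpperHalfOffRoadAtMultTwo : Prop :=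
  ∀ (W₀ : WeierstrassCurve ℚ) [W₀.IsElliptic] [W₀.IsGloballyMinimal]
    [NeZero (W₀.conductorNorm ℤ)], ¬ W₀.HasCM → W₀.analyticRank = 0 → Mult W₀ 2 →
    ∀ D₀ : ModularParametrizationData W₀ (W₀.conductorNorm ℤ), Zhai2021.IsOptimalDatum W₀ D₀ →
    (¬ ∀ (κ : ZpExtension ℚ 2) (γ : Field.absoluteGaloisGroup ℚ), κ.IsCyclotomic →
        κ.IsTopGenerator γ → IsCyclotomicVariable 2 γ → ∀ D : W₀.SelmerDualData κ γ, D.mu = 0) →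
    (¬ ∃ x y : ℚ, W₀.toAffine.Equation x y ∧ 2 * y + W₀.a₁ * x + W₀.a₃ = 0 ∧
        ((TwoTorsionRamifiedAtTwo x ∧ ¬ TwoTorsionOdd W₀ x) ∨
          (TwoTorsionOdd W₀ x ∧ ¬ TwoTorsionRamifiedAtTwo x))) →
    MissingUpperBoundAt W₀ 2

/-! ## Bookkeeping: the constants unfold to the binders verbatim -/

/-- `GreenbergStevensAtSplitTwo` unfolds to the binder `hGS`. [folklore] -/
theorem greenbergStevensAtSplitTwo_iff : GreenbergStevensAtSplitTwo ↔
    ∀ (W : WeierstrassCurve ℚ) [W.IsElliptic] [W.IsGloballyMinimal],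
      W.HasSplitMultiplicativeReductionAtPrime 2 → greenberg_stevens (W := W) (p := 2) :=
  Iff.rfl

/-- `KatoRatAtMultTwo` unfolds to the binder `hKato`. [folklore] -/
theorem katoRatAtMultTwo_iff : KatoRatAtMultTwo ↔
    ∀ (W : WeierstrassCurve ℚ) [W.IsElliptic] [W.IsGloballyMinimal],
      ¬ W.HasCM → Mult W 2 → O1.KatoMultiplicativeDivisibilityRat W 2 :=
  Iff.rfl

end Summit.BirchSwinnertonDyer.BirchSwinnertonDyer.Theorems.MultUpperHalvesAtTwo

end
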